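import Literature.InformationTheory.Entanglement.MajorizationCriterion
import Literature.LinearAlgebra.Matrix.ConverseInterlacing
import Literature.LinearAlgebra.Matrix.LidskiiMajorizationVariants
import Literature.LinearAlgebra.Matrix.PosSemidefBlockCompressions
import HarnessLib

/-!
# Separable states with prescribed global and local spectra (Nielsen–Kempe 2001, Theorem 2): if
# `λ(ρ_{AB}) ≺ λ(ρ_A)` then some SEPARABLE `σ` has `λ(σ) = λ(ρ_{AB})` and `λ(σ_A) = λ(ρ_A)`

Hodge foundations lane (`lit-hodgefound`, prover p24 gen 77; quantum-information series, sequel of the lane's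
`MajorizationCriterion.lean` (Nielsen–Kempe Thm 1, the majorization criterion) and of `ConverseInterlacing.lean`
(Horn's Theorem 4.3.48)).  THEOREMS ONLY: no definition, no named fact, net debt 0.

## Source, VERBATIM — M. A. Nielsen, J. Kempe, *Separable states are more disordered globally than locally*, Phys.
Rev. Lett. **86** (2001) 5184 [NielsenKempe2001] (held `paper:arxiv-quant-ph_0011117`, chunk p0004)

«Given the isospectral example it is natural to ask under what conditions a separable state exists, given
specified global and local spectra. We can report the following result in this direction.
**Theorem 2:** If `ρ_{AB}` is a density matrix such that `λ(ρ_{AB}) ≺ λ(ρ_A)`, then there exists a separable density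
matrix `σ_{AB}` such that `λ(σ_{AB}) = λ(ρ_{AB})` and `λ(σ_A) = λ(ρ_A)`.
*Proof:* Suppose `(r_j) = λ(ρ_{AB})` and `(s_k) = λ(ρ_A)`. By Horn's lemma [Horn54a, Nielsen00c], there is a unitary
matrix `u_{jk}` such that `s_j = Σ_k |u_{jk}|² r_k`. Introduce orthonormal bases `|j⟩` for system `B` and `|k⟩` for
system `A`, and for each non-zero `r_j` define `|ψ_j⟩ ≡ Σ_k u_{jk} √s_k |k⟩ / √r_j`. (11) Then define
`σ ≡ Σ_j r_j |ψ_j⟩⟨ψ_j| ⊗ |j⟩⟨j|`. Note that `σ` is manifestly separable with spectrum `λ(ρ_{AB})`, while a simple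
calculation shows that `tr_B(σ) = Σ_k s_k |k⟩⟨k|`, and thus `λ(σ_A) = λ(ρ_A)`, completing the proof. □»
(Convention of the paper, chunk p0003: «By convention we append zeroes to the vectors `λ(ρ_A)` and `λ(ρ_B)` so they
have the same dimension as `λ(ρ_{AB})`.»)

## Dictionary (no definitions introduced)

* As in `MajorizationCriterion.lean`: `ρ = ρ_{AB} : Matrix (m × n) (m × n) ℂ` positive semidefinite of trace one,
  `ρ_A = traceRight ρ`; the zero-padded decreasing spectrum is `λ↓_j = σ_j = (toEuclideanLin ·).singularValues j`
  (`j : ℕ`), so «`λ(ρ_{AB}) ≺ λ(ρ_A)`» (with the padding convention) is `∀ k, Σ_{j<k} σ_j(ρ) ≤ Σ_{j<k} σ_j(ρ_A)`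
  (equality of the total sums, `= 1`, being automatic for states), «`λ(σ) = λ(ρ)`» is `∀ j, σ_j(σ) = σ_j(ρ)`.
* The system `B` of `σ` carries the orthonormal basis `|j⟩` indexed by the eigenvalue list of `ρ_{AB}`: it is
  `ℂ^N`, `N = |m|·|n|`, i.e. `σ : Matrix (m × Fin N) (m × Fin N) ℂ`; «separable» = the tree's `PPT.IsSeparable`.
* Horn's lemma = the tree's `exists_orthogonal_diag_eq_of_majorize` (`ConverseInterlacing.lean`; a real orthogonal `u`, so
  `|u_{jk}|² = u_{jk}²`).

## Remarks on the printed proof (recorded, the formal statement follows the correct reading)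

* The displayed `s_j = Σ_k |u_{jk}|² r_k` has `r` and `s` interchanged: Horn's lemma for `λ(ρ_{AB}) = r ≺ s` gives
  `r_j = Σ_k |u_{jk}|² s_k`, which is what the normalisation `‖ψ_j‖ = 1` in (11) requires; we use this form.
* We use the un-normalised vectors `φ_j = Σ_k u_{jk} √s_k |k⟩` (`= √r_j ψ_j`), so that `σ = Σ_j φ_jφ_j^* ⊗ |j⟩⟨j|`
  needs no case split at `r_j = 0`; and since `Σ_k s_k|k⟩⟨k|` is taken in the eigenbasis of `ρ_A`, one gets the
  sharper `tr_B σ = ρ_A` (not only equality of spectra).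
* `λ(σ) = λ(ρ_{AB})`: `σ = WW^*` for `W = [φ_j ⊗ |j⟩]_j`, and `W^*W = diag(‖φ_j‖²) = diag(r)`.

## What is formalized (all PROVED)

`exists_isSeparable_spectrum_eq_traceRight_eq` (**Theorem 2**, with `tr_B σ = ρ_A`), its corollary
`exists_isSeparable_spectra_eq` (spectra of `σ` and `σ_A` as printed), and the separable-input repackaging
`exists_isSeparable_spectra_eq_of_isSeparable` (Theorem 1 feeds Theorem 2).

## Tree / Mathlib search (2026-08-31)

REUSED: `MajorizationCriterion.{singularValues_mul_conjTranspose_comm, sum_singularValues_eq_one_of_card_le,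
sum_singularValues_le_traceRight_of_isSeparable}`, `Literature.LinearAlgebra.Matrix.exists_orthogonal_diag_eq_of_majorize`
(Horn, `ConverseInterlacing.lean`),
`Lidskii.ithLargest_eq_self_of_antitone`, `Literature.LinearAlgebra.Matrix.{singularValues_toEuclideanLin_diagonal,
singularValues_eq_eigenvalues₀_of_posSemidef, singularValues_toEuclideanLin_of_card_le}`,
`PosSemidefBlockCompressions.posSemidef_traceRight`, `SepDecomp.isSeparable_iff_sepD`; Mathlib
`IsHermitian.spectral_theorem`, `eigenvectorUnitary`, `posSemidef_vecMulVec_self_star`.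

## References

* [NielsenKempe2001] M. A. Nielsen, J. Kempe, Phys. Rev. Lett. 86 (2001) 5184, Theorem 2 with proof, eq. (11)
  (arXiv:quant-ph/0011117, chunk p0004).
* [HornJohnson2013] R. A. Horn, C. R. Johnson, *Matrix Analysis*, 2nd ed., Thm 4.3.48 (Horn) — the tree's file.
-/

noncomputable section

open Matrix Finset
open scoped ComplexOrder Kronecker ComplexConjugate

namespace Literature.InformationTheory.Entanglement.SeparableStatesPrescribedSpectra

open Literature.InformationTheory.Entanglement.PPT (IsSeparable)
open Literature.InformationTheory.Entanglement.SepDecomp (isSeparable_iff_sepD)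
open Literature.InformationTheory.Entanglement.MajorizationCriterion (singularValues_mul_conjTranspose_comm
  sum_singularValues_eq_one_of_card_le sum_singularValues_le_traceRight_of_isSeparable)
open Literature.Computability.QuantumComplexity (traceRight traceRight_apply trace_traceRight)
open Literature.LinearAlgebra.Matrix (singularValues_eq_eigenvalues₀_of_posSemidef
  singularValues_toEuclideanLin_of_card_le singularValues_toEuclideanLin_diagonal exists_orthogonal_diag_eq_of_majorize)
open Literature.LinearAlgebra.Matrix.Lidskii (ithLargest_eq_self_of_antitone)
open Literature.LinearAlgebra.Matrix.PosSemidefBlockCompressions (posSemidef_traceRight)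

variable {m n : Type*} [Fintype m] [Fintype n] [DecidableEq m] [DecidableEq n]

/-- Bookkeeping: a sum over `{i : Fin N | i < ℓ}` of an `ℕ`-indexed family is the sum over `range (min ℓ N)`.
[folklore] -/
private theorem sum_filter_lt_eq_sum_range_min (f : ℕ → ℝ) (N ℓ : ℕ) :
    ∑ i ∈ univ.filter (fun i : Fin N => (i : ℕ) < ℓ), f i = ∑ j ∈ range (min ℓ N), f j := by
  rw [Finset.sum_filter, Fin.sum_univ_eq_sum_range (fun j => if j < ℓ then f j else 0) N, ← Finset.sum_filter]
  congr 1
  ext j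
  simp only [mem_filter, mem_range, lt_min_iff, and_comm]

/-- **Theorem 2 (Nielsen–Kempe), sharp form.** Let `ρ` be a density matrix on `ℂ^m ⊗ ℂ^n` with
`λ(ρ) ≺ λ(ρ_A)` (zero-padded decreasing spectra: `Σ_{j<k} λ↓_j(ρ) ≤ Σ_{j<k} λ↓_j(Tr_B ρ)` for all `k`).  Then there is a
SEPARABLE density matrix `σ` on `ℂ^m ⊗ ℂ^N`, `N = |m||n|` (system `B` spanned by `|j⟩`, `j` running over the
eigenvalue list of `ρ`), with the same padded spectrum, `λ↓_j(σ) = λ↓_j(ρ)` for every `j`, and with `Tr_B σ = Tr_B ρ`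
— the construction `σ = Σ_j r_j |ψ_j⟩⟨ψ_j| ⊗ |j⟩⟨j|`, `√r_j |ψ_j⟩ = Σ_k u_{jk} √s_k |k⟩`, `u` from Horn's lemma.
[cite: NielsenKempe2001, Thm 2 and proof, eq. (11)] [cite: HornJohnson2013, Thm 4.3.48] -/
theorem exists_isSeparable_spectrum_eq_traceRight_eq {ρ : Matrix (m × n) (m × n) ℂ} (hρ : ρ.PosSemidef)
    (hρ1 : ρ.trace = 1)
    (hmaj : ∀ k : ℕ, ∑ j ∈ range k, (Matrix.toEuclideanLin ρ).singularValues j ≤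
      ∑ j ∈ range k, (Matrix.toEuclideanLin (traceRight ρ)).singularValues j) :
    ∃ σ : Matrix (m × Fin (Fintype.card (m × n))) (m × Fin (Fintype.card (m × n))) ℂ,
      IsSeparable σ ∧ traceRight σ = traceRight ρ ∧
        ∀ j : ℕ, (Matrix.toEuclideanLin σ).singularValues j = (Matrix.toEuclideanLin ρ).singularValues j := by
  classical
  -- notation
  set N : ℕ := Fintype.card (m × n) with hN
  have hA : (traceRight ρ).PosSemidef := posSemidef_traceRight hρ
  have hA1 : (traceRight ρ).trace = 1 := by rw [trace_traceRight, hρ1]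
  -- `|m| ≤ N` (the second factor is nonempty since `Tr ρ = 1`)
  have hmN : Fintype.card m ≤ N := by
    have hpos : 0 < N := by
      by_contra h0
      have : IsEmpty (m × n) := Fintype.card_eq_zero_iff.1 (Nat.le_zero.1 (not_lt.1 h0))
      rw [Matrix.trace, Fintype.sum_empty] at hρ1
      exact zero_ne_one hρ1
    rw [hN, Fintype.card_prod] at hpos ⊢
    exact Nat.le_mul_of_pos_right _ (Nat.pos_of_mul_pos_left hpos)
  -- the padded spectra `r = λ(ρ)`, `s = λ(ρ_A)` as antitone vectors on `Fin N`
  set r : Fin N → ℝ := fun i => (Matrix.toEuclideanLin ρ).singularValues i with hr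
  set s : Fin N → ℝ := fun i => (Matrix.toEuclideanLin (traceRight ρ)).singularValues i with hs
  have hr_anti : Antitone r := fun i j hij => LinearMap.singularValues_antitone _ (Fin.le_def.1 hij)
  have hs_anti : Antitone s := fun i j hij => LinearMap.singularValues_antitone _ (Fin.le_def.1 hij)
  have hr_nn : ∀ i, 0 ≤ r i := fun i => LinearMap.singularValues_nonneg _ _
  have hsum : ∑ i, r i = ∑ i, s i := by
    rw [Fin.sum_univ_eq_sum_range (fun j => (Matrix.toEuclideanLin ρ).singularValues j) N,
      Fin.sum_univ_eq_sum_range (fun j => (Matrix.toEuclideanLin (traceRight ρ)).singularValues j) N,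
      sum_singularValues_eq_one_of_card_le hρ hρ1 le_rfl, sum_singularValues_eq_one_of_card_le hA hA1 hmN]
  have hsum1 : ∑ i, r i = 1 := by
    rw [Fin.sum_univ_eq_sum_range (fun j => (Matrix.toEuclideanLin ρ).singularValues j) N,
      sum_singularValues_eq_one_of_card_le hρ hρ1 le_rfl]
  have hpre : ∀ ℓ : ℕ, ∑ i ∈ univ.filter (fun i : Fin N => (i : ℕ) < ℓ), r i ≤
      ∑ i ∈ univ.filter (fun i : Fin N => (i : ℕ) < ℓ), s i := fun ℓ => by
    rw [sum_filter_lt_eq_sum_range_min (fun j => (Matrix.toEuclideanLin ρ).singularValues j),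
      sum_filter_lt_eq_sum_range_min (fun j => (Matrix.toEuclideanLin (traceRight ρ)).singularValues j)]
    exact hmaj _
  -- Horn's lemma: `r_j = (Qᵀ diag(s) Q)_{jj} = Σ_k Q_{kj}² s_k` for a real orthogonal `Q`
  obtain ⟨Q, hQ, hdiag⟩ := exists_orthogonal_diag_eq_of_majorize hs_anti hr_anti hsum hpre
  have hQQ : Q * Qᵀ = 1 := (Matrix.mem_orthogonalGroup_iff _ _).1 hQ
  -- eigen-data of `ρ_A`: `ρ_A = U diag(λ) U^*`
  set lam : m → ℝ := hA.isHermitian.eigenvalues with hlam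
  set U : Matrix m m ℂ := (hA.isHermitian.eigenvectorUnitary : Matrix m m ℂ) with hU
  have hUmem : U ∈ Matrix.unitaryGroup m ℂ := hA.isHermitian.eigenvectorUnitary.2
  have hAU : traceRight ρ = U * diagonal (fun a => ((lam a : ℝ) : ℂ)) * Uᴴ := by
    rw [← star_eq_conjTranspose]; exact hA.isHermitian.spectral_theorem
  have hlam_nn : ∀ a, 0 ≤ lam a := fun a => hA.eigenvalues_nonneg a
  -- the embedding `ι : m ↪ Fin N` of the eigenvalue indices of `ρ_A` into the padded list, `s (ι a) = λ_a`
  set em : Fin (Fintype.card m) ≃ m := Fintype.equivOfCardEq (Fintype.card_fin _) with hem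
  set ι : m → Fin N := fun a => Fin.castLE hmN (em.symm a) with hι
  have hι_inj : Function.Injective ι := fun a b hab => by
    have h := congrArg Fin.val hab
    simp only [hι, Fin.val_castLE] at h
    exact em.symm.injective (Fin.ext h)
  have hsι : ∀ a, s (ι a) = lam a := fun a => by
    show (Matrix.toEuclideanLin (traceRight ρ)).singularValues ((em.symm a : Fin (Fintype.card m)) : ℕ) = _
    rw [singularValues_eq_eigenvalues₀_of_posSemidef hA (em.symm a)]
    rfl
  have hs_off : ∀ k : Fin N, k ∉ univ.image ι → s k = 0 := fun k hk => by
    apply singularValues_toEuclideanLin_of_card_le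
    by_contra hlt
    refine hk (mem_image.2 ⟨em ⟨k, not_le.1 hlt⟩, mem_univ _, ?_⟩)
    apply Fin.ext
    simp only [hι, Fin.val_castLE, Equiv.symm_apply_apply]
  -- sums over `Fin N` of families vanishing off the image of `ι`
  have hreindex : ∀ f : Fin N → ℝ, (∀ k, k ∉ univ.image ι → f k = 0) → ∑ k, f k = ∑ a, f (ι a) := by
    intro f hf
    rw [← Finset.sum_subset (subset_univ (univ.image ι)) fun k _ hk => hf k hk,
      Finset.sum_image fun a _ b _ hab => hι_inj hab]
  -- Horn read on the image of `ι`: `r_j = Σ_a Q_{ι a, j}² λ_a`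
  have hrj : ∀ j, r j = ∑ a, Q (ι a) j ^ 2 * lam a := fun j => by
    rw [← hdiag j, Matrix.mul_apply]
    simp only [mul_diagonal, transpose_apply]
    rw [hreindex (fun k => Q k j * s k * Q k j) fun k hk => by rw [hs_off k hk, mul_zero, zero_mul]]
    exact sum_congr rfl fun a _ => by rw [hsι]; ring
  -- the coefficient matrix `C_{a j} = Q_{ι a, j} √λ_a` and the vectors `φ_j = U C e_j` (columns of `Φ = U C`)
  set C : Matrix m (Fin N) ℂ := Matrix.of fun a j => ((Q (ι a) j : ℝ) : ℂ) * (Real.sqrt (lam a) : ℂ) with hC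
  set Φ : Matrix m (Fin N) ℂ := U * C with hΦ
  -- `C C^* = diag(λ)` (rows of `Q` orthonormal, `ι` injective)
  have hCC : C * Cᴴ = diagonal (fun a => ((lam a : ℝ) : ℂ)) := by
    ext a b
    rw [Matrix.mul_apply, diagonal_apply]
    have hre : ∀ j, C a j * Cᴴ j b =
        (((Q (ι a) j * Q (ι b) j : ℝ) : ℂ)) * ((Real.sqrt (lam a) : ℂ) * (Real.sqrt (lam b) : ℂ)) := fun j => by
      simp only [hC, conjTranspose_apply, of_apply, star_mul', Complex.star_def, Complex.conj_ofReal,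
        Complex.ofReal_mul]
      ring
    simp_rw [hre]
    rw [← Finset.sum_mul, ← Complex.ofReal_sum]
    have h1 : ∑ j, Q (ι a) j * Q (ι b) j = (Q * Qᵀ) (ι a) (ι b) := by
      rw [Matrix.mul_apply]; rfl
    rw [h1, hQQ, one_apply]
    by_cases hab : a = b
    · subst hab
      rw [if_pos rfl, if_pos rfl, Complex.ofReal_one, one_mul, ← Complex.ofReal_mul, Real.mul_self_sqrt (hlam_nn a)]
    · rw [if_neg (fun h => hab (hι_inj h)), if_neg hab, Complex.ofReal_zero, zero_mul]
  -- hence `Φ Φ^* = ρ_A`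
  have hΦΦ : Φ * Φᴴ = traceRight ρ := by
    rw [hΦ, conjTranspose_mul, Matrix.mul_assoc, ← Matrix.mul_assoc C, hCC, ← Matrix.mul_assoc, hAU]
  -- and `(Φ^*Φ)_{jj} = (C^*C)_{jj} = Σ_a Q_{ι a j}² λ_a = r_j`
  have hUU : Uᴴ * U = 1 := by
    rw [← star_eq_conjTranspose]; exact Matrix.mem_unitaryGroup_iff'.1 hUmem
  have hΦnorm : ∀ j, (Φᴴ * Φ) j j = ((r j : ℝ) : ℂ) := fun j => by
    rw [hΦ, conjTranspose_mul, Matrix.mul_assoc, ← Matrix.mul_assoc Uᴴ, hUU, Matrix.one_mul, Matrix.mul_apply,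
      hrj j, Complex.ofReal_sum]
    refine sum_congr rfl fun a _ => ?_
    simp only [hC, conjTranspose_apply, of_apply, star_mul', Complex.star_def, Complex.conj_ofReal]
    have hsq : (Real.sqrt (lam a) : ℂ) * (Real.sqrt (lam a) : ℂ) = (lam a : ℂ) := by
      rw [← Complex.ofReal_mul, Real.mul_self_sqrt (hlam_nn a)]
    push_cast
    linear_combination ((Q (ι a) j : ℂ)) ^ 2 * hsq
  -- the basis `|j⟩` of system `B` and the state `σ = Σ_j φ_jφ_j^* ⊗ |j⟩⟨j|`
  set e : Fin N → Fin N → ℂ := fun j => Pi.single j 1 with he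
  have he1 : ∀ j, e j ⬝ᵥ star (e j) = 1 := fun j => by
    simp [he, dotProduct, Pi.single_apply]
  set σ : Matrix (m × Fin N) (m × Fin N) ℂ :=
    ∑ j, vecMulVec (fun x => Φ x j) (star fun x => Φ x j) ⊗ₖ vecMulVec (e j) (star (e j)) with hσ
  -- `σ = W W^*` with `W = [φ_j ⊗ |j⟩]_j`, and `W^*W = diag(r)`
  set W : Matrix (m × Fin N) (Fin N) ℂ := Matrix.of fun xi j => Φ xi.1 j * e j xi.2 with hW
  have hσW : σ = W * Wᴴ := by
    ext ⟨x, i⟩ ⟨y, i'⟩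
    simp only [hσ, hW, Matrix.sum_apply, Matrix.kroneckerMap_apply, vecMulVec_apply, Pi.star_apply, mul_apply,
      conjTranspose_apply, of_apply, star_mul']
    exact sum_congr rfl fun j _ => by ring
  have hWW : Wᴴ * W = diagonal (fun j => ((r j : ℝ) : ℂ)) := by
    ext j j'
    rw [Matrix.mul_apply, diagonal_apply, Fintype.sum_prod_type]
    simp only [hW, conjTranspose_apply, of_apply, star_mul']
    -- `Σ_x Σ_i conj(φ_j x) conj(e_j i) φ_j' x e_j' i = (Σ_x conj(φ_j x) φ_j' x) (Σ_i conj(e_j i) e_j' i)`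
    have hsplit : ∑ x, ∑ i, star (Φ x j) * star (e j i) * (Φ x j' * e j' i) =
        (∑ x, star (Φ x j) * Φ x j') * ∑ i, star (e j i) * e j' i := by
      rw [Finset.sum_mul_sum]
      exact sum_congr rfl fun x _ => sum_congr rfl fun i _ => by ring
    rw [hsplit]
    have hee : ∑ i, star (e j i) * e j' i = if j = j' then 1 else 0 := by
      by_cases hjj : j = j'
      · subst hjj; simp [he, Pi.single_apply]
      · rw [if_neg hjj]
        refine sum_eq_zero fun i _ => ?_
        by_cases hi : i = j
        · subst hi; simp [he, Ne.symm hjj]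
        · simp [he, Pi.single_apply, hi]
    rw [hee]
    by_cases hjj : j = j'
    · subst hjj
      rw [if_pos rfl, if_pos rfl, mul_one, ← hΦnorm j, Matrix.mul_apply]
      exact sum_congr rfl fun x _ => by rw [conjTranspose_apply]
    · rw [if_neg hjj, if_neg hjj, mul_zero]
  refine ⟨σ, ?_, ?_, ?_⟩
  · -- separable: `Tr σ = Σ_j r_j = 1`, and `σ = Σ_j P_j ⊗ Q_j` with `P_j, Q_j ⪰ 0`
    refine isSeparable_iff_sepD.2 ⟨?_, Fin N, inferInstance, fun j => vecMulVec (fun x => Φ x j) (star fun x => Φ x j),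
      fun j => vecMulVec (e j) (star (e j)), fun j => posSemidef_vecMulVec_self_star _,
      fun j => posSemidef_vecMulVec_self_star _, rfl⟩
    rw [hσ, trace_sum]
    simp only [trace_kronecker, trace_vecMulVec, he1, mul_one]
    have htr : ∀ j, (fun x => Φ x j) ⬝ᵥ (star fun x => Φ x j) = ((r j : ℝ) : ℂ) := fun j => by
      rw [← hΦnorm j, Matrix.mul_apply, dotProduct]
      exact sum_congr rfl fun x _ => by rw [conjTranspose_apply, Pi.star_apply, mul_comm]
    simp_rw [htr]
    rw [← Complex.ofReal_sum, hsum1, Complex.ofReal_one]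
  · -- `Tr_B σ = Σ_j φ_jφ_j^* = Φ Φ^* = ρ_A`
    rw [← hΦΦ]
    ext x y
    rw [traceRight_apply, Matrix.mul_apply]
    simp only [hσ, Matrix.sum_apply, Matrix.kroneckerMap_apply, vecMulVec_apply, Pi.star_apply, conjTranspose_apply]
    rw [Finset.sum_comm]
    refine sum_congr rfl fun j _ => ?_
    have h1 : ∑ b, Φ x j * star (Φ y j) * (e j b * star (e j b)) = Φ x j * star (Φ y j) * ∑ b, e j b * star (e j b) := by
      rw [Finset.mul_sum]
    rw [h1]
    have h2 : ∑ b, e j b * star (e j b) = 1 := by rw [← he1 j, dotProduct]; rfl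
    rw [h2, mul_one]
  · -- `λ(σ) = λ(WW^*) = λ(W^*W) = λ(diag r) = r = λ(ρ)`
    intro j
    rw [hσW, singularValues_mul_conjTranspose_comm, hWW]
    by_cases hj : j < N
    · have hjc : j < Fintype.card (Fin N) := by rwa [Fintype.card_fin]
      set ec : Fin (Fintype.card (Fin N)) ≃ Fin N := finCongr (Fintype.card_fin N) with hec
      have hval : ∀ i : Fin (Fintype.card (Fin N)), ((ec i : Fin N) : ℕ) = (i : ℕ) := fun i => by
        simp [hec]
      have hanti : Antitone ((fun i : Fin N => ‖((r i : ℝ) : ℂ)‖) ∘ ec) := fun i i' hii' => by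
        show ‖((r (ec i') : ℝ) : ℂ)‖ ≤ ‖((r (ec i) : ℝ) : ℂ)‖
        rw [Complex.norm_real, Complex.norm_real, Real.norm_of_nonneg (hr_nn _), Real.norm_of_nonneg (hr_nn _)]
        refine hr_anti (Fin.le_def.2 ?_)
        rw [hval, hval]
        exact Fin.le_def.1 hii'
      have h := singularValues_toEuclideanLin_diagonal (fun i : Fin N => ((r i : ℝ) : ℂ)) ec ⟨j, hjc⟩
      rw [ithLargest_eq_self_of_antitone hanti] at h
      rw [show ((⟨j, hjc⟩ : Fin (Fintype.card (Fin N))) : ℕ) = j from rfl] at h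
      rw [h]
      show ‖((r (ec ⟨j, hjc⟩) : ℝ) : ℂ)‖ = _
      rw [Complex.norm_real, Real.norm_of_nonneg (hr_nn _)]
      show (Matrix.toEuclideanLin ρ).singularValues ((ec ⟨j, hjc⟩ : Fin N) : ℕ) = _
      rw [hval]
    · rw [singularValues_toEuclideanLin_of_card_le _ (by rw [Fintype.card_fin]; exact not_lt.1 hj),
        singularValues_toEuclideanLin_of_card_le _ (not_lt.1 hj)]

/-- **Theorem 2 (Nielsen–Kempe) as printed**: under `λ(ρ_{AB}) ≺ λ(ρ_A)` there is a separable `σ` with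
`λ(σ_{AB}) = λ(ρ_{AB})` and `λ(σ_A) = λ(ρ_A)` (padded spectra, entrywise).
[cite: NielsenKempe2001, Thm 2] -/
theorem exists_isSeparable_spectra_eq {ρ : Matrix (m × n) (m × n) ℂ} (hρ : ρ.PosSemidef) (hρ1 : ρ.trace = 1)
    (hmaj : ∀ k : ℕ, ∑ j ∈ range k, (Matrix.toEuclideanLin ρ).singularValues j ≤
      ∑ j ∈ range k, (Matrix.toEuclideanLin (traceRight ρ)).singularValues j) :
    ∃ σ : Matrix (m × Fin (Fintype.card (m × n))) (m × Fin (Fintype.card (m × n))) ℂ,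
      IsSeparable σ ∧
        (∀ j : ℕ, (Matrix.toEuclideanLin σ).singularValues j = (Matrix.toEuclideanLin ρ).singularValues j) ∧
        ∀ j : ℕ, (Matrix.toEuclideanLin (traceRight σ)).singularValues j =
          (Matrix.toEuclideanLin (traceRight ρ)).singularValues j := by
  obtain ⟨σ, hsep, htr, hspec⟩ := exists_isSeparable_spectrum_eq_traceRight_eq hρ hρ1 hmaj
  exact ⟨σ, hsep, hspec, fun j => by rw [htr]⟩

/-- **Theorem 1 feeds Theorem 2**: every separable `ρ` (indeed every state passing the majorization criterion)
has a separable «spectral twin» `σ` of the special form `Σ_j r_j |ψ_j⟩⟨ψ_j| ⊗ |j⟩⟨j|` on `ℂ^m ⊗ ℂ^{|m||n|}` with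
`λ(σ) = λ(ρ)` and `Tr_B σ = Tr_B ρ`. [cite: NielsenKempe2001, Thm 1 and Thm 2] -/
theorem exists_isSeparable_spectra_eq_of_isSeparable {ρ : Matrix (m × n) (m × n) ℂ} (hρ : IsSeparable ρ) :
    ∃ σ : Matrix (m × Fin (Fintype.card (m × n))) (m × Fin (Fintype.card (m × n))) ℂ,
      IsSeparable σ ∧ traceRight σ = traceRight ρ ∧
        ∀ j : ℕ, (Matrix.toEuclideanLin σ).singularValues j = (Matrix.toEuclideanLin ρ).singularValues j :=
  exists_isSeparable_spectrum_eq_traceRight_eq hρ.posSemidef hρ.trace_eq_one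
    (sum_singularValues_le_traceRight_of_isSeparable hρ)

end Literature.InformationTheory.Entanglement.SeparableStatesPrescribedSpectra
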